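import Mathlib
import HarnessLib
import Summits.Langlands.Langlands.Theses.ParityBlindBianchi
import Summits.Langlands.Langlands.Theorems.ParityBlindBianchiArtinWeightRealisationLevelSolvableSector
import Literature.NumberTheory.Automorphic.PiOfArtinRepAtSigmaUnramifiedPlaces

/-!
# The open residue of R′ = `ParityBlindBianchi.ArtinWeightRealisationLevel` (crux stmt-Langlands-15111)
is exactly its INSOLUBLE (icosahedral) sector — line `Sketch`, continuation lead c1 (`--supports`)

Finite subgroups of `PGL₂` over an algebraically closed field of characteristic `0` are cyclic,
dihedral, `A₄`, `S₄` (solvable) or `A₅`.  The landed solvable sector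
(`satakeFrobCompatibleAt_of_isSolvable_projectiveImage`, `…SolvableSector`:
Langlands–Tunnell in automorphic form `strongArtin_of_isSolvable` + Gelbart 1997 Prop. 4.1
σ-unramified shadow) produces, for a finite-image irreducible `σ : Γ_K → GL₂(ℚ̄_p)` with SOLVABLE
projective image, a cuspidal `π` compatible with `σ` at every place where `σ` is unramified —
without any `p`-adic automorphy hypothesis and without the cusp-form existence fact (the solvable
sector needs no special treatment of the degenerate sector `0 ∈ S₀`: `π(σ)` exists regardless).
Hence R′ is implied, modulo these two named facts, by ITS OWN RESTRICTION to representations with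
non-solvable projective image (`¬ IsSolvable (projectiveImage σ)`, i.e. projectively `A₅`):
`artinWeightRealisationLevel_of_insoluble_sector`.  The restriction is taken as a HYPOTHESIS written
out verbatim (R′ with `¬ IsSolvable (projectiveImage σ.toMonoidHom) →` inserted after
irreducibility); nothing is claimed about it — it is the open content of the crux (equivalently, by
`artinWeightRealisationLevel_iff_artinWeightRealisation`, of the shared crux stmt-Langlands-11057):
classicality at the singular (Artin) weight of a `p`-adically automorphic icosahedral `σ` over an
imaginary quadratic field.  No definitions.
-/

noncomputable section

open scoped BigOperators Topology Classical Matrix NumberField MatrixGroups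
open Literature.NumberTheory.Automorphic Literature.NumberTheory.GaloisRepresentations
  IsDedekindDomain NumberField Filter

-- `Summit.Langlands.Langlands.…`: summit = sub-problem name (D-0017 nested layout), not a typo.
set_option linter.dupNamespace false

namespace Summit.Langlands.Langlands.Theorems.ArtinWeightRealisationLevel

/-- **R′ reduces to its insoluble (icosahedral) sector.**  Under Langlands–Tunnell in automorphic
form (`strongArtin_of_isSolvable`) and Gelbart 1997 Prop. 4.1 (σ-unramified shadow,
`frobSatakeCompatibleAt_of_isPiOfArtinRep_of_isUnramifiedAt`), the crux
`ParityBlindBianchi.ArtinWeightRealisationLevel` follows from its restriction to finite-image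
irreducible `σ` whose projective image is NOT solvable (third hypothesis: the statement of R′
verbatim with `¬ IsSolvable (projectiveImage σ.toMonoidHom)` inserted).  Proof: case split on
solvability; the solvable case is `satakeFrobCompatibleAt_of_isSolvable_projectiveImage`
(compatibility at every `σ`-unramified place; a good place is `σ`-unramified by the association
hypothesis `IsHeckeAssociatedAt.isUnramifiedAt`). [folklore] -/
theorem artinWeightRealisationLevel_of_insoluble_sector : Literature.NumberTheory.Automorphic.strongArtin_of_isSolvable → Literature.NumberTheory.Automorphic.frobSatakeCompatibleAt_of_isPiOfArtinRep_of_isUnramifiedAt → (∀ (K : Type) [Field K] [NumberField K], NumberField.IsTotallyComplex K → Module.finrank ℚ K = 2 → ∀ (p : ℕ) [Fact p.Prime] (ι : PadicAlgCl p ≃+* ℂ) (σ : Literature.NumberTheory.GaloisRepresentations.FramedGaloisRep K (PadicAlgCl p) 2), Finite σ.toMonoidHom.range → σ.toGaloisRep.IsIrreducible → ¬ IsSolvable (Literature.NumberTheory.GaloisRepresentations.projectiveImage σ.toMonoidHom) → ∀ S₀ : Finset ℕ, p ∈ S₀ → (∃ (U : Subgroup (GL (Fin 2) (IsDedekindDomain.FiniteAdeleRing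 (NumberField.RingOfIntegers K) K))) (ϖ : ∀ v : IsDedekindDomain.HeightOneSpectrum (NumberField.RingOfIntegers K), (v.adicCompletion K)ˣ) (a : {v : IsDedekindDomain.HeightOneSpectrum (NumberField.RingOfIntegers K) // ∀ ℓ ∈ S₀, ((ℓ : ℕ) : NumberField.RingOfIntegers K) ∉ v.asIdeal} → ℕ → (Valued.v (R := PadicAlgCl p)).valuationSubring), IsOpen (U : Set (GL (Fin 2) (IsDedekindDomain.FiniteAdeleRing (NumberField.RingOfIntegers K) K))) ∧ U ≤ Literature.NumberTheory.Automorphic.glFiniteIntegralLevel 2 K ∧ (∀ g ∈ Literature.NumberTheory.Automorphic.glFiniteIntegralLevel 2 K, (∀ v : IsDedekindDomain.HeightOneSpectrum (NumberField.RingOfIntegers K), ¬ (∀ ℓ ∈ S₀, ((ℓ : ℕ) : NumberField.RingOfIntegers K) ∉ v.asIdeal) → ∀ i j : Fin 2, ((g : Matrix (Fin 2) (Fin 2) (IsDedekindDomain.FiniteAdeleRing (NumberField.RingOfIntegers K) K)) i j) v = (1 : Matrix (Fin 2) (Fin 2) (v.adicCompletion K)) i j) → g ∈ U) ∧ (∀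 v : IsDedekindDomain.HeightOneSpectrum (NumberField.RingOfIntegers K), Valued.v ((ϖ v : (v.adicCompletion K)ˣ) : v.adicCompletion K) = WithZero.exp (-1 : ℤ)) ∧ Literature.NumberTheory.Automorphic.IsHeckePoint (Matrix.GeneralLinearGroup.map (n := Fin 2) (algebraMap K (IsDedekindDomain.FiniteAdeleRing (NumberField.RingOfIntegers K) K))) (Literature.NumberTheory.Automorphic.LevelTower.ofSeq U (fun r : ℕ => (Literature.NumberTheory.Automorphic.principalCongruenceLevel 2 K (Ideal.span {((p : ℕ) : NumberField.RingOfIntegers K)} ^ r)).map (Literature.NumberTheory.Automorphic.GLn.sndHom 2 K))) ((p : ℕ) : (Valued.v (R := PadicAlgCl p)).valuationSubring) (fun j : {v : IsDedekindDomain.HeightOneSpectrum (NumberField.RingOfIntegers K) // ∀ ℓ ∈ S₀, ((ℓ : ℕ) : NumberField.RingOfIntegers K) ∉ v.asIdeal} × Fin 2 => Literature.NumberTheory.Automorphic.GLn.sndHom 2 K (Literature.NumberTheory.Automorphic.heckeDiagAt 2 K j.1.1 (ϖ j.1.1) (j.2.val + 1))) (fun j => a j.1 (j.2.val + 1)) ∧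 ∀ (v : IsDedekindDomain.HeightOneSpectrum (NumberField.RingOfIntegers K)) (hv : ∀ ℓ ∈ S₀, ((ℓ : ℕ) : NumberField.RingOfIntegers K) ∉ v.asIdeal), σ.IsHeckeAssociatedAt v (fun i : ℕ => if i = 0 then (1 : PadicAlgCl p) else ((a ⟨v, hv⟩ i : (Valued.v (R := PadicAlgCl p)).valuationSubring) : PadicAlgCl p))) → ∃ (hcpt : Literature.NumberTheory.Automorphic.isCompact_glFiniteIntegralLevel 2 K) (π : Literature.NumberTheory.Automorphic.CuspidalAutomorphicRepData 2 K hcpt), ∀ w : IsDedekindDomain.HeightOneSpectrum (NumberField.RingOfIntegers K), (∀ ℓ ∈ S₀, ((ℓ : ℕ) : NumberField.RingOfIntegers K) ∉ w.asIdeal) → Summit.Langlands.SatakeFrobCompatibleAt ι π.1 σ w) → Summit.Langlands.Langlands.Theses.ParityBlindBianchi.ArtinWeightRealisationLevel := by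
  intro hLT hG h5 K _ _ htc hdeg p _ ι σ hfin hirr S₀ hp hyp
  by_cases hs : IsSolvable (projectiveImage σ.toMonoidHom)
  · obtain ⟨hcpt, π, hπ⟩ :=
      satakeFrobCompatibleAt_of_isSolvable_projectiveImage hLT
        (fun hcpt σ π hπ v hv => hG hcpt σ π hπ v hv) K p ι σ hfin hirr hs
    refine ⟨hcpt, π, fun w hw => hπ w ?_⟩
    obtain ⟨U, ϖ, a, -, -, -, -, -, hassoc⟩ := hyp
    exact (hassoc w hw).isUnramifiedAt
  · exact h5 K htc hdeg p ι σ hfin hirr hs S₀ hp hyp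

end Summit.Langlands.Langlands.Theorems.ArtinWeightRealisationLevel

end
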